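import Summits.QuantumAdvantage.QuantumAdvantage.Theorems.MobiusLadderAC0Rung

/-!
# Stub `stub_influenceAC0` (rung R2) of line `Sketch` for the crux `ArithStatLadder.IqThreeNotPPoly`

**Polynomial-size constant-depth circuits have total influence `o(n)`** (Linial–Mansour–Nisan 1993 /
Boppana 1997, here through A. Tal's Fourier-tail bound, Tal 2017, Theorem 3.6, PROVED in the tree).
Given the truncated Fourier formula for the total influence (rung R1, taken as a hypothesis)
`I[f] ≤ k + n · W^{≥ k+1}[sgn ∘ f]` for every level `k`, and the tree's tail bound for circuits over
`acBasis` of `acDepth ≤ d`, `size ≤ s` (`GreenAC0.tailWeight_circuit_le`: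
`W^{≥ k}[sgn ∘ C] ≤ tailBound (logM (2s)) (d+2) 1 k`), which is eventually `≤ (ε/3)²` at every level
`k + 1 ≥ n^c / (2(⌊log₂ n⌋ + 1))` (`MobiusLadder.tail_term_eventually`), we take `c = 1`,
`k = ⌊n / (2(⌊log₂ n⌋ + 1))⌋` and `ε = 3 √(δ/2)`: then `n · W^{≥ k+1} ≤ δ n / 2`, and
`k ≤ n / (2(⌊log₂ n⌋ + 1)) ≤ δ n / 2` as soon as `⌊log₂ n⌋ ≥ ⌈1/δ⌉` (i.e. `n ≥ 2^{⌈1/δ⌉}`), whence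
`I[C] ≤ δ n` for every depth-`d`, size-`≤ p(n)` circuit `C` over `acBasis`, eventually in `n`.

## References

* N. Linial, Y. Mansour, N. Nisan, *Constant depth circuits, Fourier transform, and learnability*,
  J. ACM 40 (1993) 607–620.
* A. Tal, *Tight bounds on the Fourier spectrum of AC⁰*, CCC 2017, Theorem 3.6 [Tal2017].
* R. O'Donnell, *Analysis of Boolean Functions*, CUP 2014, §2.3–2.4, §4.5 [ODonnell2014].
-/

set_option linter.dupNamespace false -- D-0017: single-problem summit ⇒ `QuantumAdvantage.QuantumAdvantage` by design

noncomputable section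

namespace Summit.QuantumAdvantage.QuantumAdvantage.Theorems.IqThreeNotPPoly

open scoped Classical BigOperators
open Filter Finset Real
open Literature.Computability.Complexity
open Literature.Computability.Complexity.LowDegree (tailWeight tailWeight_nonneg)
open Literature.Computability.Complexity.ACForm (tailBound logM)
open Literature.Probability.RandomGraphs.LowDegree (sgn)
open Literature.NumberTheory.Sieve (GreenAC0.tailWeight_circuit_le)
open Summit.QuantumAdvantage.QuantumAdvantage.Theorems.MobiusLadder (tail_term_eventually)

/-- The level bookkeeping: if `2^{⌈1/δ⌉} ≤ n` and `k ≤ n / (2(⌊log₂ n⌋ + 1))` then `k ≤ (δ/2) n`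
(because `⌊log₂ n⌋ + 1 ≥ ⌈1/δ⌉ ≥ 1/δ`). -/
theorem influenceAC0_level_le {δ : ℝ} (hδ : 0 < δ) {n k : ℕ} (hn : 2 ^ ⌈1 / δ⌉₊ ≤ n)
    (hk : (k : ℝ) ≤ (n : ℝ) / (2 * ((Nat.log 2 n : ℝ) + 1))) : (k : ℝ) ≤ δ / 2 * n := by
  have hJj : ⌈1 / δ⌉₊ ≤ Nat.log 2 n := Nat.le_log_of_pow_le one_lt_two hn
  have hj0 : (0 : ℝ) < (Nat.log 2 n : ℝ) + 1 := by positivity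
  have h1 : 1 ≤ δ * ((Nat.log 2 n : ℝ) + 1) := by
    have hJ' : 1 / δ ≤ (⌈1 / δ⌉₊ : ℝ) := Nat.le_ceil _
    have hJj' : (⌈1 / δ⌉₊ : ℝ) ≤ Nat.log 2 n := by exact_mod_cast hJj
    calc (1 : ℝ) = δ * (1 / δ) := by field_simp
      _ ≤ δ * ((Nat.log 2 n : ℝ) + 1) := mul_le_mul_of_nonneg_left (by linarith) hδ.le
  have hk2 : (k : ℝ) * (2 * ((Nat.log 2 n : ℝ) + 1)) ≤ n := by
    rwa [le_div_iff₀ (by positivity)] at hk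
  have hk0 : (0 : ℝ) ≤ k := Nat.cast_nonneg k
  calc (k : ℝ) = k * 1 := (mul_one _).symm
    _ ≤ k * (δ * ((Nat.log 2 n : ℝ) + 1)) := mul_le_mul_of_nonneg_left h1 hk0
    _ = δ / 2 * (k * (2 * ((Nat.log 2 n : ℝ) + 1))) := by ring
    _ ≤ δ / 2 * n := mul_le_mul_of_nonneg_left hk2 (by positivity)

/-- **RUNG STUB R2 · `stub_influenceAC0`** (Linial–Mansour–Nisan; Tal 2017, Theorem 3.6 as proved in
the tree): the truncated influence formula `I[f] ≤ k + n · W^{≥ k+1}[sgn ∘ f]` (R1) implies that for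
fixed depth `d`, size polynomial `p` and `δ > 0`, eventually in `n`, every circuit `C` over `acBasis`
with `acDepth ≤ d` and `size ≤ p(n)` has total influence `I[C] ≤ δ n`. Proof: level
`k = ⌊n / (2(⌊log₂ n⌋ + 1))⌋` (`c = 1` in `MobiusLadder.tail_term_eventually`, `ε = 3 √(δ/2)` so that
`(ε/3)² = δ/2`), Tal's tail `GreenAC0.tailWeight_circuit_le` with `s = max 1 (p(n))`, and
`influenceAC0_level_le`. [cite: Tal2017, Theorem 3.6] [cite: ODonnell2014, §4.5] -/
theorem stub_influenceAC0 :
    (∀ (n k : ℕ) (f : (Fin n → Bool) → Bool),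
      (∑ i : Fin n, ((Finset.univ.filter
          (fun x : Fin n → Bool => f x ≠ f (Function.update x i (!x i)))).card : ℝ)) / 2 ^ n
        ≤ k + n * LowDegree.tailWeight
          (fun x => Literature.Probability.RandomGraphs.LowDegree.sgn (f x)) (k + 1)) →
    ∀ (d : ℕ) (p : Polynomial ℕ) (δ : ℝ), 0 < δ →
      ∀ᶠ n : ℕ in Filter.atTop, ∀ C : Circuit (Fin n), C.IsOver acBasis → C.acDepth ≤ d →
        C.size ≤ p.eval n →
          (∑ i : Fin n, ((Finset.univ.filter
            (fun x : Fin n → Bool => C.eval x ≠ C.eval (Function.update x i (!x i)))).card : ℝ)) /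
              2 ^ n ≤ δ * n := by
  intro hR1 d p δ hδ
  -- `ε = 3 √(δ/2)`, so that `(ε/3)² = δ/2`
  set ε : ℝ := 3 * Real.sqrt (δ / 2) with hε
  have hε0 : 0 < ε := by positivity
  have hε3 : (ε / 3) ^ 2 = δ / 2 := by
    rw [hε, show 3 * Real.sqrt (δ / 2) / 3 = Real.sqrt (δ / 2) by ring, Real.sq_sqrt (by positivity)]
  filter_upwards [tail_term_eventually d p (c := 1) one_pos hε0, eventually_ge_atTop (2 ^ ⌈1 / δ⌉₊)]
    with n htail hn C hCB hdepth hsize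
  -- the level `k = ⌊n / (2(⌊log₂ n⌋ + 1))⌋`
  set j := Nat.log 2 n with hj
  set k : ℕ := ⌊(n : ℝ) ^ (1 : ℝ) / (2 * ((j : ℝ) + 1))⌋₊ with hk
  have hj0 : (0 : ℝ) < (j : ℝ) + 1 := by positivity
  have hq0 : 0 ≤ (n : ℝ) ^ (1 : ℝ) / (2 * ((j : ℝ) + 1)) := by positivity
  have hk_le : (k : ℝ) ≤ (n : ℝ) ^ (1 : ℝ) / (2 * ((j : ℝ) + 1)) := Nat.floor_le hq0
  have hk_lt : (n : ℝ) ^ (1 : ℝ) / (2 * ((j : ℝ) + 1)) ≤ (k : ℝ) + 1 := (Nat.lt_floor_add_one _).le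
  rw [Real.rpow_one] at hk_le
  have hkδ : (k : ℝ) ≤ δ / 2 * n := influenceAC0_level_le hδ hn hk_le
  -- the size parameter `s ≥ 1`
  set s := max 1 (p.eval n) with hs
  have hs1 : 1 ≤ s := le_max_left _ _
  have hsize' : C.size ≤ s := hsize.trans (le_max_right _ _)
  -- Tal's tail, eventually `≤ (ε/3)² = δ/2`
  have htw : tailWeight (fun x => sgn (C.eval x)) (k + 1) ≤ δ / 2 :=
    calc tailWeight (fun x => sgn (C.eval x)) (k + 1)
        ≤ tailBound (logM (2 * s)) (d + 2) 1 (k + 1) :=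
          GreenAC0.tailWeight_circuit_le C hCB hdepth hsize' hs1 (k + 1)
      _ ≤ (ε / 3) ^ 2 := htail k hk_lt
      _ = δ / 2 := hε3
  have hn0 : (0 : ℝ) ≤ n := Nat.cast_nonneg n
  -- R1 at level `k`
  calc (∑ i : Fin n, ((Finset.univ.filter
          (fun x : Fin n → Bool => C.eval x ≠ C.eval (Function.update x i (!x i)))).card : ℝ)) / 2 ^ n
      ≤ k + n * tailWeight (fun x => sgn (C.eval x)) (k + 1) := hR1 n k C.eval
    _ ≤ δ / 2 * n + n * (δ / 2) := add_le_add hkδ (mul_le_mul_of_nonneg_left htw hn0)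
    _ = δ * n := by ring

end Summit.QuantumAdvantage.QuantumAdvantage.Theorems.IqThreeNotPPoly

end
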